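/-
Copyright (c) 2026. All rights reserved.
Released under Apache 2.0 license as described in the file LICENSE.
-/
import Literature.NumberTheory.Automorphic.BrandtSetupTwoSidedIdealTransport
import Literature.NumberTheory.Automorphic.BrandtModuleSignSpaceDimension
import Literature.NumberTheory.Automorphic.BrandtModuleSignSpacesEquidistribution
import HarnessLib

/-!
# Principal products of the two-sided ideals `𝔓_q`, `𝔔_{p^e}` of an Eichler order are generated by elements of reduced norm
# `∏ q · ∏ p^e`, and the fixed points of the sign group `(ℤ/2ℤ)^T` on `Cls O` counted by such elements
# (Voight Lemma 18.5.1, Prop. 18.5.10, 23.3.19, 23.4.14; Martin JNT 188 Prop. 12)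

[tag: quaternion_algebra] [tag: eichler_order] [tag: class_number] [tag: hecke_operator]

Topic `NumberTheory/Automorphic`. Two definitions with body (`Brandt.localNorm N⁺ N⁻ r = r` for `r ∣ N⁻`, `r^{v_r(N⁺)}`
otherwise — the reduced norm of the local generator of the admissible ideal `T_r`; `Brandt.suppSort T g` — the increasing
enumeration of the support of a sign-group element `g : T → ℤ/2ℤ`) and theorems; no named fact, no instance, no notation.
Lane `lit-hodgefound`, seat p12, gen 53 — the arithmetic sequel of `BrandtSetupTwoSidedIdealTransport.lean` (#3).

THE PRINTED STATEMENTS (J. Voight, *Quaternion Algebras*, GTM 288). **Lemma 18.5.1** «`α ∈ N_{B^×}(O)` iff `αO = Oα` iff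
`OαO` is a principal two-sided `O`-ideal»; **Prop. 18.5.10**: the fibre of `Cls O → Typ O` over the type of `O′` is
`PIdl(O′) \ Idl(O′)`; **23.3.19 / Thm. 18.1.3 (local, ramified)**: `P = O π`, `nrd(P) = 𝔭`; **23.4.13–23.4.14 (local, level
`𝔭^e`)**: `I = O ϖ`, `ϖ² = π^e`, `N(O)/(F^× O^×) = ⟨ϖ⟩`; hence a two-sided ideal `∏_q 𝔓_q ∏_p 𝔔_{p^{e_p}}` is principal iff it
is `αO` with `α ∈ N(O)` of reduced norm `∏ q ∏ p^{e_p}` (up to `F^×`; over `ℚ` in a definite algebra: exactly). K. Martin,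
*J. Number Theory* 188 (2018) §3 Prop. 12 with *Canad. J. Math.* 70 (2018) §4: `2^{#T} dim M^χ(O) = Σ_{g} χ(g) #Fix(Φ_T g)`.

For a Brandt setup `S : XiSetup N⁺ N⁻` (definite algebra `D` of discriminant `N⁻`, Eichler order `O` of level `N⁺`) the tree has
`T_r(O') = XiSetup.twoSidedIdeal`, `P_l(O') = XiSetup.twoSidedIdealProd` (a list `l` of primes), `(W_{r_k} ∘ ⋯ ∘ W_{r_1}) c = c ⟺
O_L(I_c) P_l(O_L(I_c))` principal, and `Φ_T(g) c` as such an iterated involution (#3). This file proves: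

* §1 `p`-adic valuations of reduced norms: units of `O₍r₎` (`v_r(nrd u) = 0 ⟺ u⁻¹ ∈ O₍r₎` for `u ∈ O₍r₎`), and **a local
  generator `g_r` of `T_r(O)` with `v_r(nrd g_r) = v_r(localNorm r)`** (a uniformiser at `r ∣ N⁻`, an Atkin–Lehner element at
  `r ∤ N⁻`; `XiSetup.exists_generator_twoSidedIdeal`);
* §2 **the local structure of `O P_l(O)`**: `(O P_l(O))₍r₎ = T_r(O)₍r₎` for `r ∈ l`, `= O₍r₎` for `r ∉ l` (`l` duplicate-free);
* §3 **PRINCIPAL ⟺ NORM ELEMENT: `(∃ x ∈ D^×, O P_l(O) = x O) ⟺ ∃ x ∈ O P_l(O), nrd x = ∏_{r ∈ l} localNorm r`**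
  (`XiSetup.exists_order_mul_twoSidedIdealProd_eq_units_smul_iff`), for `O` and for every left order `O_L(I)`;
* §4 classes: **`(W_{r_k} ∘ ⋯ ∘ W_{r_1}) c = c ⟺ ∃ x ∈ O_L(I_c) P_l(O_L(I_c)), nrd x = ∏ localNorm`**
  (`XiSetup.foldl_atkinLehner_eq_self_iff_exists_reducedNorm_eq`), **`Φ_T(g) c = c ⟺ …`**, `#Fix(Φ_T g) = #{c : …}`, and
  **Martin's Prop. 12 in arithmetic form for EVERY finite set `T` of primes (level primes included):
  `2^{#T} dim M^χ(O) = Σ_{g ∈ (ℤ/2ℤ)^T} χ(g) · #{c ∈ Cls O : ∃ x ∈ O_L(I_c) P_{supp g}(O_L(I_c)), nrd x = ∏_{r ∈ supp g} localNorm r}`**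
  (`XiSetup.two_pow_mul_finrank_signSpace_eq_sum_natCard_norm`), the level analogue of
  `BrandtModuleRamifiedSignSpaceDimension.lean`; and the Burnside count of the types
  `2^{#T} · #Typ O = Σ_g #{c : …}` for `T ⊇` primes of `N⁺N⁻`;
* §5 **the equidistribution criterion at an arbitrary `T`**: all `dim M^χ(O)` (`χ ∈ (ℤ/2ℤ)^T^∨`) are equal iff for every
  `g ≠ 0` and every class `c` the ideal `O_L(I_c) P_{supp g}(O_L(I_c))` has no element of reduced norm `∏ localNorm`
  (`XiSetup.forall_finrank_signSpace_eq_iff_forall_not_exists_norm`) — Martin's Cor. 8 with the level primes allowed.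

## References

* [Voight2021] J. Voight, *Quaternion Algebras*, GTM 288 (2021): Lemma 18.5.1, Prop. 18.5.10, Thm. 18.1.3, 23.3.19, Prop.
  23.4.14, (23.4.20), (41.3.5).
* [VignerasLNM800] M.-F. Vignéras, *Arithmétique des algèbres de quaternions*, LNM 800 (1980), Ch. II §1 Cor. 1.7, Ch. II §2,
  Ch. III §5 exercice 5.8, Ch. V §2.
* [Martin2018RefinedDimensions] K. Martin, *Refined dimensions of cusp forms, and equidistribution and bias of signs*, J. Number
  Theory 188 (2018), §3 Prop. 12.
* [Martin2018] K. Martin, *Congruences for modular forms mod 2 and quaternionic `S`-ideal classes*, Canad. J. Math. 70 (2018), §4.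

## Scope (honest)

Two definitions and theorems. The counts `#{c : ∃ x ∈ O_L(I_c) P(O_L(I_c)), nrd x = n}` are not evaluated (optimal-embedding
numbers / Eichler's trace formula).
-/

noncomputable section

open scoped Pointwise

universe u

namespace Literature.NumberTheory.Automorphic

open AtkinLehner

namespace Brandt

/-- **The local norm at `r` of the admissible two-sided ideal**: `r` at a ramified prime `r ∣ N⁻` (`nrd 𝔓_r = r`),
`r^{v_r(N⁺)}` at `r ∤ N⁻` (`nrd 𝔔_{r^e} = r^e`; `1` if `r ∤ N⁺N⁻`). [cite: Voight2021, 23.3.19 and Prop. 23.4.14] -/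
def localNorm (Nplus Nminus r : ℕ) : ℕ := if r ∣ Nminus then r else r ^ Nplus.factorization r

/-- `localNorm r = r` at `r ∣ N⁻`. [cite: Voight2021, 23.3.19] -/
theorem localNorm_of_dvd {Nplus Nminus r : ℕ} (h : r ∣ Nminus) : localNorm Nplus Nminus r = r := by
  unfold localNorm; rw [if_pos h]

/-- `localNorm r = r^{v_r(N⁺)}` at `r ∤ N⁻`. [cite: Voight2021, Prop. 23.4.14] -/
theorem localNorm_of_not_dvd {Nplus Nminus r : ℕ} (h : ¬ r ∣ Nminus) : localNorm Nplus Nminus r = r ^ Nplus.factorization r := by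
  unfold localNorm; rw [if_neg h]

/-- `localNorm r = r ^ a_r` with `a_r = 1` (`r ∣ N⁻`) or `v_r(N⁺)` (`r ∤ N⁻`). [cite: Voight2021, (23.4.20)] -/
theorem localNorm_eq_pow (Nplus Nminus r : ℕ) :
    localNorm Nplus Nminus r = r ^ (if r ∣ Nminus then 1 else Nplus.factorization r) := by
  unfold localNorm; split_ifs <;> simp

/-- `localNorm r ≠ 0` for `r ≠ 0`. [cite: Voight2021, 23.3.19 and Prop. 23.4.14] -/
theorem localNorm_ne_zero {Nplus Nminus r : ℕ} (hr : r ≠ 0) : localNorm Nplus Nminus r ≠ 0 := by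
  rw [localNorm_eq_pow]; exact pow_ne_zero _ hr

/-- `v_r(localNorm r') = 0` for distinct primes `r ≠ r'`. [cite: Voight2021, 23.3.19 and Prop. 23.4.14] -/
theorem padicValNat_localNorm_of_ne {Nplus Nminus r r' : ℕ} (hr : r.Prime) (hr' : r'.Prime) (h : r ≠ r') :
    padicValNat r (localNorm Nplus Nminus r') = 0 := by
  haveI : Fact r.Prime := ⟨hr⟩
  haveI : Fact r'.Prime := ⟨hr'⟩
  rw [localNorm_eq_pow]
  exact padicValNat_prime_prime_pow _ h

/-- `v_r(localNorm r) = a_r`. [cite: Voight2021, 23.3.19 and Prop. 23.4.14] -/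
theorem padicValNat_localNorm_self {Nplus Nminus r : ℕ} (hr : r.Prime) :
    padicValNat r (localNorm Nplus Nminus r) = if r ∣ Nminus then 1 else Nplus.factorization r := by
  haveI : Fact r.Prime := ⟨hr⟩
  rw [localNorm_eq_pow, padicValNat.prime_pow]

/-- **`v_r(∏_{r' ∈ l} localNorm r') = a_r [r ∈ l]`** for a duplicate-free list `l` of primes.
[cite: Voight2021, 23.3.19, Prop. 23.4.14 and (23.4.20)] -/
theorem padicValNat_prod_localNorm {Nplus Nminus : ℕ} {l : List ℕ} (hl : ∀ r ∈ l, r.Prime) (hnd : l.Nodup) {r : ℕ}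
    (hr : r.Prime) :
    padicValNat r (l.map (localNorm Nplus Nminus)).prod =
      if r ∈ l then (if r ∣ Nminus then 1 else Nplus.factorization r) else 0 := by
  haveI : Fact r.Prime := ⟨hr⟩
  induction l with
  | nil => simp
  | cons r₀ l ih =>
    have hl' : ∀ r' ∈ l, r'.Prime := fun r' h => hl r' (List.mem_cons_of_mem _ h)
    have hr₀ : r₀.Prime := hl r₀ (by simp)
    obtain ⟨hr₀l, hnd'⟩ := List.nodup_cons.mp hnd
    have hprod0 : (l.map (localNorm Nplus Nminus)).prod ≠ 0 :=
      List.prod_ne_zero fun h => by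
        obtain ⟨r', hr', h0⟩ := List.mem_map.mp h
        exact localNorm_ne_zero (hl' r' hr').ne_zero h0
    rw [List.map_cons, List.prod_cons, padicValNat.mul (localNorm_ne_zero hr₀.ne_zero) hprod0, ih hl' hnd']
    by_cases h : r = r₀
    · subst h
      rw [padicValNat_localNorm_self hr, if_neg hr₀l, add_zero, if_pos (List.mem_cons_self (a := r) (l := l))]
    · rw [padicValNat_localNorm_of_ne hr hr₀ h, zero_add]
      by_cases hm : r ∈ l
      · rw [if_pos hm, if_pos (List.mem_cons_of_mem _ hm)]
      · rw [if_neg hm, if_neg (by simp [h, hm])]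

variable {Nplus Nminus : ℕ} (S : XiSetup Nplus Nminus)

/-- The algebra of a setup is a division algebra. [folklore] -/
private theorem XiSetup.hdiv₅₆ : ∀ x : S.D, x ≠ 0 → IsUnit x :=
  fun _ hx => isUnit_of_isTotallyDefinite S.D S.isTotallyDefinite hx

/-- The reduced norm of a unit of the algebra of a setup is non-zero. [folklore] -/
private theorem XiSetup.reducedNorm_units_ne_zero₅₆ (u : S.Dˣ) : reducedNorm ℚ S.D (u : S.D) ≠ 0 :=
  (isUnit_iff_reducedNorm_ne_zero_holds ℚ S.D (u : S.D)).mp u.isUnit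

/-- Reduced norms of units are positive (definite algebra). [folklore] -/
private theorem XiSetup.reducedNorm_units_pos₅₆ (u : S.Dˣ) : 0 < reducedNorm ℚ S.D (u : S.D) :=
  lt_of_le_of_ne (reducedNorm_nonneg_of_isTotallyDefinite S.D S.isTotallyDefinite _) (S.reducedNorm_units_ne_zero₅₆ u).symm

/-! ## §1 Valuations of reduced norms: local units and local generators -/

/-- **`u⁻¹ ∈ O₍r₎ ⟺ v_r(nrd u) = 0`** for a unit `u` of `D` lying in `O₍r₎` (`nrd u, nrd u⁻¹ ∈ ℤ₍r₎`, resp. `u⁻¹ = ū / nrd u`).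
[cite: VignerasLNM800, Ch. I §4 Lemme 4.1] [cite: Voight2021, Lemma 18.5.1] -/
theorem XiSetup.units_inv_mem_localAt_iff_padicValRat {O' : Submodule ℤ S.D} (hO' : IsZOrder O') {r : ℕ} [hr : Fact r.Prime]
    {u : S.Dˣ} (hu : (u : S.D) ∈ localAt r O') :
    ((u⁻¹ : S.Dˣ) : S.D) ∈ localAt r O' ↔ padicValRat r (reducedNorm ℚ S.D (u : S.D)) = 0 := by
  have h1 : 0 ≤ padicValRat r (reducedNorm ℚ S.D (u : S.D)) :=
    (not_dvd_den_iff_padicValRat_nonneg (p := r)).mp (hO'.not_dvd_den_reducedNorm_of_mem_localAt hu)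
  constructor
  · intro hinv
    have h2 : 0 ≤ padicValRat r (reducedNorm ℚ S.D ((u⁻¹ : S.Dˣ) : S.D)) :=
      (not_dvd_den_iff_padicValRat_nonneg (p := r)).mp (hO'.not_dvd_den_reducedNorm_of_mem_localAt hinv)
    rw [reducedNorm_units_inv, padicValRat.inv] at h2
    linarith
  · intro h0
    have hden : r ∣ (reducedNorm ℚ S.D (u : S.D) / r).den := by
      by_contra hnd
      have h := (not_dvd_den_iff_padicValRat_nonneg (p := r)).mp hnd
      rw [padicValRat.div (S.reducedNorm_units_ne_zero₅₆ u) (by exact_mod_cast hr.out.ne_zero), h0,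
        padicValRat.self hr.out.one_lt] at h
      norm_num at h
    obtain ⟨hx0, hinv⟩ := inv_mem_localAt_of_dvd_den hO' S.hdiv₅₆ hu hden
    have hux : (S.hdiv₅₆ (u : S.D) hx0).unit = u := Units.ext rfl
    rwa [hux] at hinv

/-- **An element of the stabiliser of `O₍r₎` has `v_r(nrd) = 0`.** [cite: VignerasLNM800, Ch. I §4 Lemme 4.1] -/
theorem XiSetup.padicValRat_reducedNorm_eq_zero_of_mem_stabilizer {O' : Submodule ℤ S.D} (hO' : IsZOrder O') {r : ℕ}
    [Fact r.Prime] {u : S.Dˣ} (hu : u ∈ MulAction.stabilizer S.Dˣ (localAt r O')) :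
    padicValRat r (reducedNorm ℚ S.D (u : S.D)) = 0 := by
  obtain ⟨h1, h2⟩ := (hO'.mem_stabilizer_localAt_iff (p := r)).mp hu
  exact (S.units_inv_mem_localAt_iff_padicValRat hO' h1).mp h2

/-- **`v_r(nrd w) = e` from `‖det Φ(w)‖ = r^{-e}`** (`det Φ = nrd`). [cite: VignerasLNM800, Ch. I §1 Lemme 1.1] -/
private theorem XiSetup.padicValRat_reducedNorm_of_norm_det {r : ℕ} [hr : Fact r.Prime]
    (Φ : S.D →ₐ[ℚ] Matrix (Fin 2) (Fin 2) ℚ_[r]) {w : S.Dˣ} {e : ℕ} (hdet : ‖(Φ (w : S.D)).det‖ = (r : ℝ) ^ (-(e : ℤ))) :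
    padicValRat r (reducedNorm ℚ S.D (w : S.D)) = e := by
  have hp1 : (1 : ℝ) < r := by exact_mod_cast hr.out.one_lt
  rw [AlgHom.det_eq_reducedNorm, show algebraMap ℚ ℚ_[r] (reducedNorm ℚ S.D (w : S.D)) =
      ((reducedNorm ℚ S.D (w : S.D) : ℚ) : ℚ_[r]) from rfl,
    Padic.norm_ratCast_eq_zpow (S.reducedNorm_units_ne_zero₅₆ w)] at hdet
  have := zpow_right_injective₀ (zero_lt_one.trans hp1) hp1.ne' hdet
  omega

/-- **A local generator of the admissible ideal with the right valuation**: for every prime `r` there is `g ∈ T_r(O)` with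
`T_r(O)₍r₎ = g O₍r₎` and `v_r(nrd g) = v_r(localNorm r)` — a uniformiser `π` of `𝔓_r` at a ramified `r` (`nrd π = r · unit`),
an Atkin–Lehner element `w` at `r ∤ N⁻` (`‖nrd w‖_r = r^{-e}`). [cite: Voight2021, 23.3.19 (`P = Oπ`) and Prop. 23.4.14 (`I = Oϖ`)] [cite: VignerasLNM800, Ch. II §1 Cor. 1.7, Ch. II §2] -/
theorem XiSetup.exists_generator_twoSidedIdeal {r : ℕ} [hr : Fact r.Prime] :
    ∃ g : S.Dˣ, (g : S.D) ∈ S.twoSidedIdeal S.O r ∧ localAt r (S.twoSidedIdeal S.O r) = g • localAt r S.O ∧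
      padicValRat r (reducedNorm ℚ S.D (g : S.D)) = (if r ∣ Nminus then 1 else Nplus.factorization r : ℕ) := by
  by_cases h : r ∣ Nminus
  · rw [S.twoSidedIdeal_of_dvd S.O h, if_pos h]
    obtain ⟨u, hu, hup⟩ := exists_uniformiser (S.hdiv_of_dvd h) S.isZOrder_O
    obtain ⟨n, hn, hpn⟩ := exists_reducedNorm_uniformiser (S.hdiv_of_dvd h) (S.maximalAt_of_dvd h) S.isZOrder_O hu hup
    refine ⟨u, hu, localAt_normPrimeIdeal_eq_units_smul (S.hdiv_of_dvd h) (S.maximalAt_of_dvd h) S.isZOrder_O hu hup, ?_⟩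
    have hn0 : (n : ℚ) ≠ 0 := by
      rintro h0
      have : n = 0 := by exact_mod_cast h0
      exact hpn (this ▸ dvd_zero _)
    rw [hn, padicValRat.mul (by exact_mod_cast hr.out.ne_zero) hn0, padicValRat.self hr.out.one_lt, padicValRat.of_int,
      padicValInt.eq_zero_of_not_dvd hpn]
    simp
  · rw [S.twoSidedIdeal_of_not_dvd S.O h, if_neg h]
    obtain ⟨Φ, hΦ⟩ := S.exists_isLevelShape_iff S.nplus_ne_zero h
    obtain ⟨w, hw, hW, hdet⟩ := exists_atkinLehner_generator Φ S.isZOrder_O hΦ S.hdiv₅₆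
    exact ⟨w, hw, localAt_atkinLehnerIdeal_eq_units_smul Φ S.isZOrder_O hΦ hw hW hdet,
      S.padicValRat_reducedNorm_of_norm_det Φ hdet⟩

/-! ## §2 The local structure of `O P_l(O)` -/

/-- **`T_{r'}(O')₍r₎ = O'₍r₎` for primes `r ≠ r'`** (the admissible ideals are locally trivial away from their prime).
[cite: VignerasLNM800, Ch. III §5 Prop. 5.1 (propriétés locales)] -/
theorem XiSetup.localAt_twoSidedIdeal_of_ne {O' : Submodule ℤ S.D} (hO' : IsZOrder O') {r r' : ℕ} (hr : r.Prime) (hr' : r'.Prime)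
    (h : r ≠ r') : localAt r (S.twoSidedIdeal O' r') = localAt r O' := by
  by_cases hd : r' ∣ Nminus
  · rw [S.twoSidedIdeal_of_dvd O' hd]; exact localAt_normPrimeIdeal_eq_of_ne hO' hr' hr h
  · rw [S.twoSidedIdeal_of_not_dvd O' hd]
    exact localAt_atkinLehnerIdeal_of_coprime hO' (pow_ne_zero _ hr'.ne_zero)
      (Nat.Coprime.pow_left _ ((Nat.coprime_primes hr' hr).mpr (Ne.symm h)))

/-- `O P_l(O) ⊆ O`. [cite: VignerasLNM800, Ch. III §5 (idéaux bilatères entiers)] -/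
theorem XiSetup.order_mul_twoSidedIdealProd_le {O' : Submodule ℤ S.D} (hO' : IsZOrder O') (l : List ℕ) :
    O' * S.twoSidedIdealProd O' l ≤ O' := by
  induction l with
  | nil => rw [S.twoSidedIdealProd_nil, mul_one]
  | cons r l ih =>
    rw [S.twoSidedIdealProd_cons, ← mul_assoc, S.order_mul_twoSidedIdeal hO', ← S.twoSidedIdeal_mul_order hO' r, mul_assoc]
    exact Submodule.mul_le.mpr fun a ha b hb => hO'.mul_mem _ (S.twoSidedIdeal_le O' r ha) _ (ih hb)

/-- **The local structure of a product of admissible ideals**: for a duplicate-free list `l` of primes and a prime `r`,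
`(O P_l(O))₍r₎ = T_r(O)₍r₎` if `r ∈ l` and `= O₍r₎` if `r ∉ l`. [cite: VignerasLNM800, Ch. III §5 Prop. 5.1] [cite: Voight2021, (23.4.20)] -/
theorem XiSetup.localAt_order_mul_twoSidedIdealProd {O' : Submodule ℤ S.D} (hO' : IsZOrder O') {l : List ℕ} (hl : ∀ r ∈ l, r.Prime)
    (hnd : l.Nodup) {r : ℕ} (hr : r.Prime) :
    localAt r (O' * S.twoSidedIdealProd O' l) = localAt r (if r ∈ l then S.twoSidedIdeal O' r else O') := by
  induction l with
  | nil => rw [S.twoSidedIdealProd_nil, mul_one, if_neg (by simp)]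
  | cons r₀ l ih =>
    have hl' : ∀ r' ∈ l, r'.Prime := fun r' h => hl r' (List.mem_cons_of_mem _ h)
    obtain ⟨hr₀l, hnd'⟩ := List.nodup_cons.mp hnd
    have e1 : O' * S.twoSidedIdealProd O' (r₀ :: l) = S.twoSidedIdeal O' r₀ * (O' * S.twoSidedIdealProd O' l) := by
      rw [S.twoSidedIdealProd_cons, ← mul_assoc, S.order_mul_twoSidedIdeal hO', ← mul_assoc, S.twoSidedIdeal_mul_order hO']
    rw [e1, ← localAt_mul_localAt_eq, ih hl' hnd']
    by_cases h : r = r₀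
    · subst h
      rw [if_neg hr₀l, if_pos (by simp), localAt_mul_localAt_eq, S.twoSidedIdeal_mul_order hO']
    · rw [S.localAt_twoSidedIdeal_of_ne hO' hr (hl r₀ (by simp)) h, localAt_mul_localAt_eq]
      by_cases hm : r ∈ l
      · rw [if_pos hm, if_pos (List.mem_cons_of_mem _ hm), S.order_mul_twoSidedIdeal hO']
      · rw [if_neg hm, if_neg (by simp [h, hm]), hO'.mul_self]

/-! ## §3 A product of admissible ideals is principal iff it contains an element of the right reduced norm -/

/-- `v_r` of a positive integer cast to `ℚ` is its `padicValNat`. [folklore] -/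
private theorem padicValRat_intCast_of_pos {r : ℕ} {k : ℤ} (hk : 0 < k) : padicValRat r (k : ℚ) = padicValNat r k.natAbs := by
  rw [show (k : ℚ) = ((k.natAbs : ℕ) : ℚ) by rw [← Int.cast_natCast, Int.natAbs_of_nonneg hk.le], padicValRat.of_nat]

/-- **PRINCIPAL ⟺ NORM ELEMENT.** For a duplicate-free list `l` of primes, the two-sided ideal `O P_l(O) = ∏_{r ∈ l} T_r(O)`
of the Eichler order `O` of a Brandt setup is principal, `= x O` with `x ∈ D^×`, **iff it contains an element of reduced
norm `∏_{r ∈ l} localNorm r`** (`= ∏ q · ∏ p^{v_p N⁺}`), which then generates it. Locally at `r ∈ l` such an `x` is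
`g_r · (unit)`, `g_r` the local generator (`π` or `ϖ`); at `r ∉ l` it is a unit of `O₍r₎`. [cite: Voight2021, Lemma 18.5.1, 23.3.19 and Prop. 23.4.14] [cite: VignerasLNM800, Ch. II §1 Cor. 1.7 and Ch. II §2] -/
theorem XiSetup.exists_order_mul_twoSidedIdealProd_eq_units_smul_iff {l : List ℕ} (hl : ∀ r ∈ l, r.Prime) (hnd : l.Nodup) :
    (∃ x : S.Dˣ, S.O * S.twoSidedIdealProd S.O l = x • S.O) ↔
      ∃ x ∈ S.O * S.twoSidedIdealProd S.O l, reducedNorm ℚ S.D x = ((l.map (localNorm Nplus Nminus)).prod : ℕ) := by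
  have hO := S.isZOrder_O
  set J := S.O * S.twoSidedIdealProd S.O l with hJ
  set n := (l.map (localNorm Nplus Nminus)).prod with hn
  have hn0 : n ≠ 0 := List.prod_ne_zero fun h => by
    obtain ⟨r', hr', h0⟩ := List.mem_map.mp h
    exact localNorm_ne_zero (hl r' hr').ne_zero h0
  have hJle : J ≤ S.O := S.order_mul_twoSidedIdealProd_le hO l
  -- valuations of `n`
  have hvn : ∀ r : ℕ, r.Prime → padicValRat r (n : ℚ) =
      ((if r ∈ l then (if r ∣ Nminus then 1 else Nplus.factorization r) else 0 : ℕ) : ℤ) := fun r hr => by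
    rw [padicValRat.of_nat, padicValNat_prod_localNorm hl hnd hr]
  constructor
  · rintro ⟨x, hx⟩
    have hxJ : (x : S.D) ∈ J := by
      rw [hx]
      have h := Submodule.smul_mem_pointwise_smul (1 : S.D) x S.O hO.one_mem
      rwa [Units.smul_def, smul_eq_mul, mul_one] at h
    refine ⟨x, hxJ, ?_⟩
    obtain ⟨k, hk⟩ := hO.exists_int_reducedNorm (hJle hxJ)
    have hkpos : 0 < k := by
      have h := S.reducedNorm_units_pos₅₆ x
      rw [hk] at h
      exact_mod_cast h
    -- compare the valuations of `nrd x = k` and `n` at every prime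
    have hval : ∀ r : ℕ, r.Prime → padicValNat r k.natAbs = padicValNat r n := fun r hr => by
      haveI : Fact r.Prime := ⟨hr⟩
      have hloc := S.localAt_order_mul_twoSidedIdealProd hO hl hnd hr
      rw [← hJ, hx, localAt_units_smul] at hloc
      have key : padicValRat r (reducedNorm ℚ S.D (x : S.D)) = padicValRat r (n : ℚ) := by
        rw [hvn r hr]
        by_cases hm : r ∈ l
        · rw [if_pos hm] at hloc ⊢
          obtain ⟨g, -, hg, hvg⟩ := S.exists_generator_twoSidedIdeal (r := r)
          rw [hg] at hloc
          have hst := S.padicValRat_reducedNorm_eq_zero_of_mem_stabilizer hO ((units_smul_localAt_eq_iff (O := S.O)).mp hloc)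
          rw [Units.val_mul, reducedNorm_mul_holds ℚ S.D, reducedNorm_units_inv,
            padicValRat.mul (inv_ne_zero (S.reducedNorm_units_ne_zero₅₆ g)) (S.reducedNorm_units_ne_zero₅₆ x),
            padicValRat.inv, hvg] at hst
          linarith
        · rw [if_neg hm] at hloc ⊢
          have hst : x ∈ MulAction.stabilizer S.Dˣ (localAt r S.O) := MulAction.mem_stabilizer_iff.mpr hloc
          rw [S.padicValRat_reducedNorm_eq_zero_of_mem_stabilizer hO hst]
          simp
      rw [hk, padicValRat_intCast_of_pos hkpos, padicValRat.of_nat] at key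
      exact_mod_cast key
    have hkn : k.natAbs = n :=
      (Nat.eq_iff_prime_padicValNat_eq k.natAbs n (Int.natAbs_ne_zero.mpr hkpos.ne') hn0).mpr hval
    rw [hk, ← hkn, ← Int.cast_natCast, Int.natAbs_of_nonneg hkpos.le]
  · rintro ⟨x, hxJ, hxn⟩
    have hx0 : x ≠ 0 := by
      rintro rfl
      rw [reducedNorm_apply_zero] at hxn
      exact hn0 (by exact_mod_cast hxn.symm)
    set X : S.Dˣ := (S.hdiv₅₆ x hx0).unit with hX
    have hXv : (X : S.D) = x := rfl
    refine ⟨X, eq_iff_forall_prime_localAt_eq.mpr fun r hr => ?_⟩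
    haveI : Fact r.Prime := ⟨hr⟩
    have hloc := S.localAt_order_mul_twoSidedIdealProd hO hl hnd hr
    rw [← hJ] at hloc
    rw [hloc, localAt_units_smul]
    by_cases hm : r ∈ l
    · rw [if_pos hm]
      obtain ⟨g, -, hg, hvg⟩ := S.exists_generator_twoSidedIdeal (r := r)
      rw [hg]
      symm
      refine (units_smul_localAt_eq_iff (O := S.O)).mpr ((hO.mem_stabilizer_localAt_iff (p := r)).mpr ?_)
      have h1 : ((g⁻¹ * X : S.Dˣ) : S.D) ∈ localAt r S.O := by
        have h := le_localAt r J hxJ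
        rw [hloc, if_pos hm, hg, mem_units_smul_submodule_iff, Units.smul_def, smul_eq_mul] at h
        rwa [Units.val_mul]
      refine ⟨h1, (S.units_inv_mem_localAt_iff_padicValRat hO h1).mpr ?_⟩
      rw [Units.val_mul, reducedNorm_mul_holds ℚ S.D, reducedNorm_units_inv,
        padicValRat.mul (inv_ne_zero (S.reducedNorm_units_ne_zero₅₆ g)) (S.reducedNorm_units_ne_zero₅₆ X), padicValRat.inv,
        hvg, hXv, hxn, hvn r hr, if_pos hm]
      simp
    · rw [if_neg hm]
      have h1 : (X : S.D) ∈ localAt r S.O := le_localAt r S.O (hJle hxJ)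
      have h2 : ((X⁻¹ : S.Dˣ) : S.D) ∈ localAt r S.O := by
        refine (S.units_inv_mem_localAt_iff_padicValRat hO h1).mpr ?_
        rw [hXv, hxn, hvn r hr, if_neg hm]
        simp
      exact (MulAction.mem_stabilizer_iff.mp ((hO.mem_stabilizer_localAt_iff (p := r)).mpr ⟨h1, h2⟩)).symm

/-- **PRINCIPAL ⟺ NORM ELEMENT for the left orders**: `O_L(I) P_l(O_L(I))` is principal iff it contains an element of
reduced norm `∏_{r ∈ l} localNorm r` (the setup `S.ofLeftOrder hI`). [cite: Voight2021, Lemma 18.5.1 and Prop. 18.5.10] -/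
theorem XiSetup.exists_leftOrder_mul_twoSidedIdealProd_eq_units_smul_iff {I : Submodule ℤ S.D} (hI : I ∈ rightIdeals S.O)
    {l : List ℕ} (hl : ∀ r ∈ l, r.Prime) (hnd : l.Nodup) :
    (∃ x : S.Dˣ, leftOrder I * S.twoSidedIdealProd (leftOrder I) l = x • leftOrder I) ↔
      ∃ x ∈ leftOrder I * S.twoSidedIdealProd (leftOrder I) l,
        reducedNorm ℚ S.D x = ((l.map (localNorm Nplus Nminus)).prod : ℕ) :=
  (S.ofLeftOrder hI).exists_order_mul_twoSidedIdealProd_eq_units_smul_iff hl hnd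

/-! ## §4 Classes: fixed points of products of Atkin–Lehner involutions, counted by norm elements -/

/-- **`(W_{r_k} ∘ ⋯ ∘ W_{r_1}) c = c ⟺ ∃ x ∈ O_L(I_c) P_l(O_L(I_c))` with `nrd x = ∏_{r ∈ l} localNorm r`** (`l` a
duplicate-free list of primes; every Brandt setup) — the common generalisation of `XiSetup.wMinus_eq_self_iff` (`l = [q]`,
`q ∣ N⁻`) and `XiSetup.wPlus_eq_self_iff` (`l = [p]`, `p ∤ N⁻`). [cite: Voight2021, Prop. 18.5.10, Lemma 18.5.1 and (23.4.20)] [cite: Martin2018, §4.1] -/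
theorem XiSetup.foldl_atkinLehner_eq_self_iff_exists_reducedNorm_eq {l : List ℕ} (hl : ∀ r ∈ l, r.Prime) (hnd : l.Nodup)
    (c : ClassSet S.O) :
    l.foldl (fun c r => S.atkinLehner r c) c = c ↔
      ∃ x ∈ leftOrder c.rep * S.twoSidedIdealProd (leftOrder c.rep) l,
        reducedNorm ℚ S.D x = ((l.map (localNorm Nplus Nminus)).prod : ℕ) := by
  rw [S.foldl_atkinLehner_eq_self_iff hl c, S.exists_leftOrder_mul_twoSidedIdealProd_eq_units_smul_iff c.rep_mem hl hnd]

section SignGroup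

variable (T : Finset ℕ)

/-- **`Φ_T(g) c = c ⟺ ∃ x ∈ O_L(I_c) P_l(O_L(I_c))` with `nrd x = ∏_{r ∈ l} localNorm r`**, `l` any duplicate-free
enumeration of the support of `g` (`T` a finite set of primes). [cite: Voight2021, Prop. 18.5.10 and (23.4.20)] [cite: Martin2018, §4.1 and §4.4] -/
theorem XiSetup.atkinLehnerHom_apply_eq_self_iff_exists_reducedNorm_eq (hT : ∀ r ∈ T, r.Prime)
    (g : T → Multiplicative (ZMod 2)) (c : ClassSet S.O) {l : List ℕ} (hnd : l.Nodup)
    (hmem : ∀ r : ℕ, r ∈ l ↔ ∃ h : r ∈ T, g ⟨r, h⟩ ≠ 1) :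
    S.atkinLehnerHom T g c = c ↔
      ∃ x ∈ leftOrder c.rep * S.twoSidedIdealProd (leftOrder c.rep) l,
        reducedNorm ℚ S.D x = ((l.map (localNorm Nplus Nminus)).prod : ℕ) := by
  rw [S.atkinLehnerHom_apply_eq_foldl T g c hnd hmem]
  exact S.foldl_atkinLehner_eq_self_iff_exists_reducedNorm_eq
    (fun r hr => by obtain ⟨h, -⟩ := (hmem r).mp hr; exact hT r h) hnd c

/-- **`#Fix(Φ_T g) = #{c ∈ Cls O : ∃ x ∈ O_L(I_c) P_l(O_L(I_c)), nrd x = ∏_{r ∈ l} localNorm r}`**, `l` any duplicate-free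
enumeration of the support of `g`. [cite: Voight2021, Prop. 18.5.10 and (41.3.5)] [cite: Martin2018RefinedDimensions, §3 Prop. 12] -/
theorem XiSetup.natCard_fixedPoints_atkinLehnerHom_eq_natCard_norm (hT : ∀ r ∈ T, r.Prime)
    (g : T → Multiplicative (ZMod 2)) {l : List ℕ} (hnd : l.Nodup) (hmem : ∀ r : ℕ, r ∈ l ↔ ∃ h : r ∈ T, g ⟨r, h⟩ ≠ 1) :
    Nat.card {c : ClassSet S.O // S.atkinLehnerHom T g c = c} =
      Nat.card {c : ClassSet S.O // ∃ x ∈ leftOrder c.rep * S.twoSidedIdealProd (leftOrder c.rep) l,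
        reducedNorm ℚ S.D x = ((l.map (localNorm Nplus Nminus)).prod : ℕ)} :=
  Nat.card_congr (Equiv.subtypeEquivRight fun c => S.atkinLehnerHom_apply_eq_self_iff_exists_reducedNorm_eq T hT g c hnd hmem)

/-- **The sorted support of a sign-group element**: the increasing duplicate-free list of the `r ∈ T` with `g_r ≠ 0`.
[cite: Martin2018RefinedDimensions, §3 (the divisors `d ∣ M`)] -/
def suppSort (g : T → Multiplicative (ZMod 2)) : List ℕ :=
  (((Finset.univ : Finset T).filter fun i => g i ≠ 1).map (Function.Embedding.subtype _)).sort (· ≤ ·)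

/-- The sorted support is duplicate-free. [cite: Martin2018RefinedDimensions, §3 (the divisors `d ∣ M`)] -/
theorem nodup_suppSort (g : T → Multiplicative (ZMod 2)) : (suppSort T g).Nodup :=
  Finset.sort_nodup _ _

/-- Membership in the sorted support. [cite: Martin2018RefinedDimensions, §3 (the divisors `d ∣ M`)] -/
theorem mem_suppSort_iff (g : T → Multiplicative (ZMod 2)) (r : ℕ) :
    r ∈ suppSort T g ↔ ∃ h : r ∈ T, g ⟨r, h⟩ ≠ 1 := by
  unfold suppSort
  rw [Finset.mem_sort, Finset.mem_map]
  constructor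
  · rintro ⟨i, hi, rfl⟩
    rw [Finset.mem_filter] at hi
    exact ⟨i.2, hi.2⟩
  · rintro ⟨hr, hg⟩
    exact ⟨⟨r, hr⟩, Finset.mem_filter.mpr ⟨Finset.mem_univ _, hg⟩, rfl⟩

/-- The members of the sorted support are primes when `T` consists of primes. [cite: Martin2018RefinedDimensions, §3] -/
theorem prime_of_mem_suppSort (hT : ∀ r ∈ T, r.Prime) (g : T → Multiplicative (ZMod 2)) {r : ℕ} (hr : r ∈ suppSort T g) :
    r.Prime := by
  obtain ⟨h, -⟩ := (mem_suppSort_iff T g r).mp hr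
  exact hT r h

/-- **MARTIN'S PROPOSITION 12 IN ARITHMETIC FORM, FOR EVERY FINITE SET `T` OF PRIMES (level primes included):
`2^{#T} · dim M^χ(O) = Σ_{g ∈ (ℤ/2ℤ)^T} χ(g) · #{c ∈ Cls O : ∃ x ∈ O_L(I_c) P_{supp g}(O_L(I_c)), nrd x = ∏_{r ∈ supp g} localNorm r}`**
— `2^{#T} dim M^χ = Σ_g χ(g) #Fix(Φ_T g)` (`BrandtModuleSignSpaceDimension.lean`) with the fixed points counted by norm
elements of the transported two-sided ideals (the level analogue of `BrandtModuleRamifiedSignSpaceDimension.lean`, where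
`T ⊆` primes of `N⁻` and the count is `#{c : O_L(I_c) ∋ x, nrd x = d_g}`). [cite: Martin2018RefinedDimensions, §3 Prop. 12] [cite: Voight2021, Prop. 18.5.10 and (41.3.5)] [cite: VignerasLNM800, Ch. V §2] -/
theorem XiSetup.two_pow_mul_finrank_signSpace_eq_sum_natCard_norm [Fintype (ClassSet S.O)] (hT : ∀ r ∈ T, r.Prime) (χ : T → ℤˣ) :
    (2 : ℚ) ^ T.card * Module.finrank ℚ (S.signSpace T χ) =
      ∑ g : T → Multiplicative (ZMod 2), ((signCharacter T χ g : ℤ) : ℚ) *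
        Nat.card {c : ClassSet S.O // ∃ x ∈ leftOrder c.rep * S.twoSidedIdealProd (leftOrder c.rep) (suppSort T g),
          reducedNorm ℚ S.D x = (((suppSort T g).map (localNorm Nplus Nminus)).prod : ℕ)} := by
  rw [S.two_pow_mul_finrank_signSpace_eq_sum T χ]
  refine Finset.sum_congr rfl fun g _ => ?_
  rw [S.natCard_fixedPoints_atkinLehnerHom_eq_natCard_norm T hT g (nodup_suppSort T g) (mem_suppSort_iff T g)]

/-- **Burnside for the sign group in arithmetic form: `Σ_{g ∈ (ℤ/2ℤ)^T} #{c : ∃ x ∈ O_L(I_c) P_{supp g}(O_L(I_c)), nrd x = ∏ localNorm}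
= 2^{#T} · h_T`**, `h_T = #Cl_T(O)` the number of `T`-ideal classes. [cite: Martin2018, §3.3 (3.9) and §4.4] [cite: Voight2021, (41.3.5)] -/
theorem XiSetup.sum_natCard_norm_eq_two_pow_mul_natCard_sClassSet [Fintype (ClassSet S.O)] (hT : ∀ r ∈ T, r.Prime) :
    ∑ g : T → Multiplicative (ZMod 2),
        Nat.card {c : ClassSet S.O // ∃ x ∈ leftOrder c.rep * S.twoSidedIdealProd (leftOrder c.rep) (suppSort T g),
          reducedNorm ℚ S.D x = (((suppSort T g).map (localNorm Nplus Nminus)).prod : ℕ)} =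
      2 ^ T.card * Nat.card (S.SClassSet T) := by
  rw [← S.sum_natCard_fixedPoints_atkinLehnerHom T]
  refine Finset.sum_congr rfl fun g _ => ?_
  rw [S.natCard_fixedPoints_atkinLehnerHom_eq_natCard_norm T hT g (nodup_suppSort T g) (mem_suppSort_iff T g)]

/-- **The type number by Burnside, arithmetically: `2^{#T} · #Typ O = Σ_{g ∈ (ℤ/2ℤ)^T} #{c : ∃ x ∈ O_L(I_c) P_{supp g}(O_L(I_c)),
nrd x = ∏_{r ∈ supp g} localNorm r}`** for every finite set of primes `T ⊇` primes of `N⁺N⁻` (the fibres of `Cls O → Typ O` are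
the orbits of the sign group; the stabilisers are the principal two-sided ideals, Voight Prop. 18.5.10) — the skeleton of the
Eichler–Deuring type number formula before the counts are evaluated by embedding numbers. [cite: Voight2021, Prop. 18.5.10, Cor. 18.5.12 and (23.4.20)] [cite: VignerasLNM800, Ch. V §2] -/
theorem XiSetup.two_pow_mul_natCard_typeSet_eq_sum_natCard_norm [Fintype (ClassSet S.O)] (hT : ∀ r ∈ T, r.Prime)
    (hT' : (Nplus * Nminus).primeFactors ⊆ T) :
    2 ^ T.card * Nat.card (TypeSet S.O) =
      ∑ g : T → Multiplicative (ZMod 2),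
        Nat.card {c : ClassSet S.O // ∃ x ∈ leftOrder c.rep * S.twoSidedIdealProd (leftOrder c.rep) (suppSort T g),
          reducedNorm ℚ S.D x = (((suppSort T g).map (localNorm Nplus Nminus)).prod : ℕ)} := by
  rw [S.sum_natCard_norm_eq_two_pow_mul_natCard_sClassSet T hT, S.natCard_sClassSet_eq_natCard_typeSet T hT']

/-- A count over `Cls O` vanishes iff the counted property never holds. [folklore] -/
private theorem natCard_subtype_eq_zero_iff₅₆ (P : ClassSet S.O → Prop) : Nat.card {c : ClassSet S.O // P c} = 0 ↔ ∀ c, ¬ P c := by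
  rw [Nat.card_eq_zero, isEmpty_subtype, or_iff_left (not_infinite_iff_finite.mpr inferInstance)]

/-- **THE EQUIDISTRIBUTION CRITERION FOR SIGN PATTERNS AT AN ARBITRARY FINITE SET `T` OF PRIMES (level primes included):**
all the sign spaces `M^χ(O)`, `χ : T → {±1}`, have the same dimension iff for every `g ≠ 0` in `(ℤ/2ℤ)^T` and every class
`c`, the two-sided ideal `O_L(I_c) P_{supp g}(O_L(I_c))` contains NO element of reduced norm `∏_{r ∈ supp g} localNorm r`
(i.e. is not principal: the sign group acts freely on `Cls O`) — Martin's Cor. 8 ∕ the equidistribution of sign patterns,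
extended from the ramified primes (`BrandtModuleSignSpacesEquidistribution.lean`) to the Atkin–Lehner involutions of the level.
[cite: Martin2018, §4.4 Cor. 8] [cite: Martin2018RefinedDimensions, §3 Prop. 12] [cite: Voight2021, Prop. 18.5.10] -/
theorem XiSetup.forall_finrank_signSpace_eq_iff_forall_not_exists_norm [Fintype (ClassSet S.O)] (hT : ∀ r ∈ T, r.Prime) :
    (∀ χ χ' : T → ℤˣ, Module.finrank ℚ (S.signSpace T χ) = Module.finrank ℚ (S.signSpace T χ')) ↔
      ∀ g : T → Multiplicative (ZMod 2), g ≠ 1 → ∀ c : ClassSet S.O,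
        ¬ ∃ x ∈ leftOrder c.rep * S.twoSidedIdealProd (leftOrder c.rep) (suppSort T g),
          reducedNorm ℚ S.D x = (((suppSort T g).map (localNorm Nplus Nminus)).prod : ℕ) := by
  rw [S.forall_finrank_signSpace_eq_iff_forall_two_pow_mul T, S.forall_finrank_signSpace_eq_iff_forall_fixedPoints T]
  refine forall₂_congr fun g _ => ?_
  rw [S.natCard_fixedPoints_atkinLehnerHom_eq_natCard_norm T hT g (nodup_suppSort T g) (mem_suppSort_iff T g),
    natCard_subtype_eq_zero_iff₅₆]

/-- Under the criterion, **`2^{#T} · dim M^χ(O) = #Cls O` for every sign pattern `χ`**. [cite: Martin2018, §4.4 Cor. 8] -/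
theorem XiSetup.two_pow_mul_finrank_signSpace_eq_of_forall_not_exists_norm [Fintype (ClassSet S.O)] (hT : ∀ r ∈ T, r.Prime)
    (h : ∀ g : T → Multiplicative (ZMod 2), g ≠ 1 → ∀ c : ClassSet S.O,
      ¬ ∃ x ∈ leftOrder c.rep * S.twoSidedIdealProd (leftOrder c.rep) (suppSort T g),
        reducedNorm ℚ S.D x = (((suppSort T g).map (localNorm Nplus Nminus)).prod : ℕ)) (χ : T → ℤˣ) :
    (2 : ℚ) ^ T.card * Module.finrank ℚ (S.signSpace T χ) = Nat.card (ClassSet S.O) :=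
  (S.forall_finrank_signSpace_eq_iff_forall_two_pow_mul T).mp ((S.forall_finrank_signSpace_eq_iff_forall_not_exists_norm T hT).mpr h) χ

end SignGroup

end Brandt

end Literature.NumberTheory.Automorphic

end
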